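import Literature.Barriers.SmoothPoincare4.ExoticOpenFourSpaceProofs
import Mathlib.Geometry.Manifold.PartitionOfUnity
import Mathlib.Topology.ContinuousMap.SecondCountableSpace
import Mathlib.Topology.ContinuousMap.Compact
import Mathlib.Analysis.Calculus.MeanValue
import Mathlib.Topology.MetricSpace.Contracting
import HarnessLib

/-!
# `deMichelisFreedman1992_continuum`: the second paragraph of the proof of Thm. 4.1 proved — uncountably many embeddings give two that differ by an ambient diffeomorphism

Proof file (sibling of `Literature.Barriers.SmoothPoincare4.ExoticOpenFourSpaceProofs`) for the
named fact `Literature.Barriers.SmoothPoincare4.deMichelisFreedman1992_continuum`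
(DeMichelis–Freedman 1992, Thm. 4.1 with Cor. 4.1: continuum many pairwise non-diffeomorphic open
subsets of standard `ℝ⁴`, each homeomorphic to `ℝ⁴`).

`ExoticOpenFourSpaceProofs` reduced the discharge of that fact (PROVED reductions) to the two
paragraphs of the printed proof of Thm. 4.1 (p. 247):
`deMichelisFreedman1992_continuum_of_core (hcore) (hgen)`, where

* `hcore` is the first paragraph — the gauge-theoretic no-go (Kotschick's `Φ`-invariant on
  end-periodic manifolds, Thm. 2.1; Freedman's structure theorem, Thm. 3.1; ribbon `ℝ⁴`'s,
  Thm. 3.2): no diffeomorphism `R⁴_s → R⁴_t`, `s ≠ t`, is the identity on the compactum `K`;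
* `hgen` is the second paragraph — "It is a general fact that a smooth compact manifold admits
  only countably many smooth embeddings, up to isotopy, into any smooth metrizable manifold"
  ([15] = Kirby–Siebenmann) — in the ambient form in which the third paragraph uses it: among
  uncountably many diffeomorphisms `φ_i : U_i ≅ M` of open neighbourhoods `U_i ⊇ K` onto a fixed
  open `M ⊆ ℝ⁴`, two (`i ≠ j`) differ on `K` by a self-diffeomorphism `h` of `M`:
  `h ∘ φ_i = φ_j` on `K`.

THIS FILE PROVES `hgen` outright (`exists_ne_diffeomorph_apply_eq_of_not_countable`, for every
finite-dimensional real normed space in place of `ℝ⁴` and every compact `K`), so that the tree's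
fact now reduces to the gauge-theoretic no-go ALONE:
`deMichelisFreedman1992_countableClasses_of_nogo`, `deMichelisFreedman1992_continuum_of_nogo`.
The argument in fact gives agreement on an open NEIGHBOURHOOD of `K`
(`exists_ne_diffeomorph_eqOn_nhd_of_not_countable`: `h ∘ φ_i = φ_j` on an open `W`,
`K ⊆ W ⊆ U_i ∩ U_j`), so the no-go is only ever needed in the weaker form "no diffeomorphism
`R⁴_s → R⁴_t`, `s ≠ t`, is the identity on a neighbourhood of `K`" (used in
`ExoticOpenFourSpacePolarNhdProofs`).

## The proof of `hgen` formalized here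

The printed route (countably many isotopy classes of embeddings, then the isotopy extension
theorem, [HirschDT1976, Ch. 8, Thms. 1.3–1.5]) needs flows of time-dependent vector fields, which
Mathlib lacks. We use instead the following elementary argument, which gives the ambient
diffeomorphism directly.

1. (Counting.) An uncountable family covered by countably many sets has an uncountable
   subfamily inside one of them (`exists_not_countable_inter_of_subset_biUnion`); in a separable
   (pseudo)metric space, among uncountably many points two distinct indices carry points at
   distance `< ε` (`exists_ne_dist_lt_of_not_countable`).
2. (Uniformization.) Extend each `φ_i`, `φ_i⁻¹` to ambient functions `F_i`, `G_i : E → E`, smooth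
   on `U_i`, `M` (`exists_extend_diffeomorph`). By 1, on an uncountable subfamily a fixed compact
   neighbourhood `L = cthickening ρ K` lies in every `U_i`; choosing for each `i` a smooth bump
   `χ_i` (`= 1` near `F_i(K)`, compact support inside `M ∩ G_i⁻¹(thickening ρ K)`, Mathlib's
   `exists_contMDiffMap_one_nhds_of_subset_interior`) and bounds `N_i ≥ ‖Dχ_i‖`,
   `B_i ≥ ‖DG_i‖` on the support, a second application of 1 makes `⌈N_i + B_i⌉` constant (`= n`).
3. (Two `C¹`-close members.) The maps `i ↦ (F_i, DF_i)|_L ∈ C(L, E × (E →L[ℝ] E))` take values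
   in a second-countable space (Mathlib's `ContinuousMap.instSecondCountableTopology`), so by 1
   there are `a ≠ b` with `‖F_b - F_a‖, ‖DF_b - DF_a‖ < ε := 1/(2(n+1))` on `L`.
4. (Perturbation of the identity.) `u := χ_a • (F_b ∘ G_a - id)` is smooth with
   `‖Du‖ ≤ ε (N_a + B_a) ≤ 1/2` everywhere and `tsupport u ⊆ M`; hence `h := id + u` is a
   diffeomorphism of `E` (injective and with `2`-Lipschitz inverse by the triangle inequality,
   surjective by the Banach fixed-point theorem, smooth inverse by the inverse function theorem
   `Homeomorph.contDiff_symm`) which is the identity off `tsupport u`, so maps `M` onto `M`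
   (`exists_diffeomorph_of_perturbation`), and `h (φ_a x) = φ_a x + (φ_b x - φ_a x) = φ_b x` for
   `x ∈ K` — indeed for `x` in the open neighbourhood `U_a ∩ F_a⁻¹(N) ∩ U_b` of `K` — since
   `χ_a = 1` on an open `N ⊇ F_a(K)`.

## References

* S. DeMichelis, M. H. Freedman, *Uncountably many exotic `R⁴`'s in standard 4-space*,
  J. Differential Geom. 35 (1992) 219–254, Thm. 4.1 and its proof, p. 247 [DeMichelisFreedman1992].
* M. W. Hirsch, *Differential Topology*, GTM 33, Springer 1976, Ch. 8 §1 (isotopy extension),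
  Thms. 1.3–1.5 [HirschDT1976].
* R. C. Kirby, L. C. Siebenmann, *Foundational Essays on Topological Manifolds, Smoothings, and
  Triangulations*, Ann. of Math. Stud. 88, 1977 [KirbySiebenmann1977].

[DeMichelisFreedman1992] [HirschDT1976] [KirbySiebenmann1977]
-/

noncomputable section

open scoped Manifold ContDiff NNReal Topology
open TopologicalSpace Set Metric Filter Function

namespace Literature.Barriers.SmoothPoincare4

/-! ### Counting: pigeonhole on a countable cover; two close points among uncountably many -/

/-- **Pigeonhole on a countable cover.** If an uncountable set `T` is covered by countably many
sets `S q`, `q ∈ D`, then `T ∩ S q` is uncountable for some `q ∈ D`. [folklore] -/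
theorem exists_not_countable_inter_of_subset_biUnion {ι β : Type*} {T : Set ι}
    (hT : ¬ T.Countable) {D : Set β} (hD : D.Countable) (S : β → Set ι)
    (hcov : T ⊆ ⋃ q ∈ D, S q) : ∃ q ∈ D, ¬ (T ∩ S q).Countable := by
  by_contra h
  push Not at h
  refine hT ?_
  have hTeq : T = ⋃ q ∈ D, (T ∩ S q) := by
    refine Subset.antisymm (fun i hi => ?_) (iUnion₂_subset fun q _ => inter_subset_left)
    obtain ⟨q, hq, hiq⟩ := mem_iUnion₂.mp (hcov hi)
    exact mem_iUnion₂.mpr ⟨q, hq, hi, hiq⟩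
  rw [hTeq]
  exact hD.biUnion h

/-- **Two close points among uncountably many.** In a separable pseudometric space, a map from
an uncountable set takes, at two distinct points of the set, values at distance `< ε`: cover the
space by the `ε/2`-balls around a countable dense set and pigeonhole. [folklore] -/
theorem exists_ne_dist_lt_of_not_countable {ι X : Type*} [PseudoMetricSpace X]
    [SeparableSpace X] {T : Set ι} (hT : ¬ T.Countable) (f : ι → X) {ε : ℝ} (hε : 0 < ε) :
    ∃ a ∈ T, ∃ b ∈ T, a ≠ b ∧ dist (f a) (f b) < ε := by
  obtain ⟨D, hDc, hDd⟩ := TopologicalSpace.exists_countable_dense X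
  have hcov : T ⊆ ⋃ q ∈ D, {i | dist (f i) q < ε / 2} := fun i _ => by
    obtain ⟨q, hq, hiq⟩ := hDd.exists_dist_lt (f i) (half_pos hε)
    exact mem_iUnion₂.mpr ⟨q, hq, hiq⟩
  obtain ⟨q, -, hq⟩ := exists_not_countable_inter_of_subset_biUnion hT hDc _ hcov
  have hnt : (T ∩ {i | dist (f i) q < ε / 2}).Nontrivial := by
    by_contra h'
    exact hq (Set.not_nontrivial_iff.mp h').finite.countable
  obtain ⟨a, ⟨haT, ha⟩, b, ⟨hbT, hb⟩, hab⟩ := hnt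
  refine ⟨a, haT, b, hbT, hab, ?_⟩
  calc dist (f a) (f b) ≤ dist (f a) q + dist (f b) q := dist_triangle_right _ _ _
    _ < ε / 2 + ε / 2 := add_lt_add ha hb
    _ = ε := add_halves ε

/-- **Two close points among uncountably many**, for a map defined on the uncountable set itself.
[folklore] -/
theorem exists_ne_dist_lt_of_not_countable' {ι X : Type*} [PseudoMetricSpace X]
    [SeparableSpace X] {T : Set ι} (hT : ¬ T.Countable) (f : T → X) {ε : ℝ} (hε : 0 < ε) :
    ∃ a b : T, a ≠ b ∧ dist (f a) (f b) < ε := by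
  have h : ¬ (univ : Set T).Countable := by
    rwa [countable_univ_iff, countable_coe_iff]
  obtain ⟨a, -, b, -, hab, hd⟩ := exists_ne_dist_lt_of_not_countable h f hε
  exact ⟨a, b, hab, hd⟩

/-! ### Calculus plumbing on open subsets of a normed space -/

section General

variable {E : Type*} [NormedAddCommGroup E] [NormedSpace ℝ E]

/-- **Ambient extensions of a diffeomorphism between open subsets.** A diffeomorphism
`φ : U ≅ M` between open subsets of `E` (open-submanifold structures) and its inverse extend (by
junk values) to functions `F, G : E → E` which are `C^∞` on `U`, resp. `M`, map `U` into `M`,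
resp. `M` into `U`, and are mutually inverse there. [folklore] -/
theorem exists_extend_diffeomorph (U M : Opens E) (φ : U ≃ₘ⟮𝓘(ℝ, E), 𝓘(ℝ, E)⟯ M) :
    ∃ F G : E → E, ContDiffOn ℝ ∞ F U ∧ ContDiffOn ℝ ∞ G M ∧
      (∀ x : U, F x = φ x) ∧ (∀ y : M, G y = φ.symm y) ∧
      (∀ x ∈ U, F x ∈ M) ∧ (∀ y ∈ M, G y ∈ U) ∧
      (∀ x ∈ U, G (F x) = x) ∧ ∀ y ∈ M, F (G y) = y := by
  classical
  let F : E → E := fun x => if hx : x ∈ U then (φ ⟨x, hx⟩ : E) else 0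
  let G : E → E := fun y => if hy : y ∈ M then (φ.symm ⟨y, hy⟩ : E) else 0
  have hF : ∀ x : U, F x = φ x := fun x => by simp [F, x.2]
  have hG : ∀ y : M, G y = φ.symm y := fun y => by simp [G, y.2]
  refine ⟨F, G, ?_, ?_, hF, hG, ?_, ?_, ?_, ?_⟩
  · intro x hx
    have h1 : ContMDiff 𝓘(ℝ, E) 𝓘(ℝ, E) ∞ (Subtype.val ∘ φ) :=
      (ContMDiff.subtypeVal_comp_iff M φ).mpr φ.contMDiff
    have h2 : ContMDiffAt 𝓘(ℝ, E) 𝓘(ℝ, E) ∞ (fun x : U => F x) ⟨x, hx⟩ := by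
      have : (fun x : U => F x) = Subtype.val ∘ φ := funext fun x => hF x
      rw [this]
      exact h1 _
    exact (contMDiffAt_iff_contDiffAt.mp (contMDiffAt_subtype_iff.mp h2)).contDiffWithinAt
  · intro y hy
    have h1 : ContMDiff 𝓘(ℝ, E) 𝓘(ℝ, E) ∞ (Subtype.val ∘ φ.symm) :=
      (ContMDiff.subtypeVal_comp_iff U φ.symm).mpr φ.symm.contMDiff
    have h2 : ContMDiffAt 𝓘(ℝ, E) 𝓘(ℝ, E) ∞ (fun y : M => G y) ⟨y, hy⟩ := by
      have : (fun y : M => G y) = Subtype.val ∘ φ.symm := funext fun y => hG y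
      rw [this]
      exact h1 _
    exact (contMDiffAt_iff_contDiffAt.mp (contMDiffAt_subtype_iff.mp h2)).contDiffWithinAt
  · intro x hx
    rw [show F x = φ ⟨x, hx⟩ from hF ⟨x, hx⟩]
    exact (φ ⟨x, hx⟩).2
  · intro y hy
    rw [show G y = φ.symm ⟨y, hy⟩ from hG ⟨y, hy⟩]
    exact (φ.symm ⟨y, hy⟩).2
  · intro x hx
    rw [show F x = φ ⟨x, hx⟩ from hF ⟨x, hx⟩, show G (φ ⟨x, hx⟩) = φ.symm (φ ⟨x, hx⟩) from
      hG (φ ⟨x, hx⟩), φ.symm_apply_apply]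
  · intro y hy
    rw [show G y = φ.symm ⟨y, hy⟩ from hG ⟨y, hy⟩,
      show F (φ.symm ⟨y, hy⟩) = φ (φ.symm ⟨y, hy⟩) from hF (φ.symm ⟨y, hy⟩), φ.apply_symm_apply]

/-- **Chain rule for a one-sided inverse on an open set**: if `F (G y) = y` on an open `s ∋ y`
and `G`, `F` are differentiable at `y`, `G y`, then `DF(G y) ∘ DG(y) = id`. [folklore] -/
theorem fderiv_comp_fderiv_eq_id {F G : E → E} {s : Set E} (hs : IsOpen s) {y : E} (hy : y ∈ s)
    (hFG : ∀ y ∈ s, F (G y) = y) (hGd : DifferentiableAt ℝ G y)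
    (hFd : DifferentiableAt ℝ F (G y)) :
    (fderiv ℝ F (G y)).comp (fderiv ℝ G y) = ContinuousLinearMap.id ℝ E := by
  have h1 : HasFDerivAt (F ∘ G) ((fderiv ℝ F (G y)).comp (fderiv ℝ G y)) y :=
    hFd.hasFDerivAt.comp y hGd.hasFDerivAt
  have h2 : HasFDerivAt (F ∘ G) (ContinuousLinearMap.id ℝ E) y := by
    refine (hasFDerivAt_id y).congr_of_eventuallyEq ?_
    filter_upwards [hs.mem_nhds hy] with z hz
    exact hFG z hz
  exact h1.unique h2

/-- **A bump times a function smooth on the bump's support is smooth**: if `χ` is `C^∞` and `g`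
is `C^∞` at every point of `tsupport χ`, then `χ • g` is `C^∞` (off `tsupport χ` it vanishes
near every point). [folklore] -/
theorem contDiff_smul_of_tsupport {F' : Type*} [NormedAddCommGroup F'] [NormedSpace ℝ F']
    {χ : E → ℝ} {g : E → F'} (hχ : ContDiff ℝ ∞ χ)
    (hg : ∀ y ∈ tsupport χ, ContDiffAt ℝ ∞ g y) :
    ContDiff ℝ ∞ fun y => χ y • g y := by
  refine contDiff_iff_contDiffAt.mpr fun y => ?_
  by_cases hy : y ∈ tsupport χ
  · exact hχ.contDiffAt.smul (hg y hy)
  · have h0 : χ =ᶠ[𝓝 y] 0 := notMem_tsupport_iff_eventuallyEq.mp hy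
    have : (fun y => χ y • g y) =ᶠ[𝓝 y] fun _ => 0 := by
      filter_upwards [h0] with z hz
      simp [hz]
    exact contDiffAt_const.congr_of_eventuallyEq this

variable [FiniteDimensional ℝ E]

/-- **A `C¹`-small smooth perturbation of the identity is a diffeomorphism of the ambient
space.** If `u : E → E` is `C^∞` with `‖Du‖ ≤ 1/2` everywhere, then `y ↦ y + u y` is a
diffeomorphism of `E`: injective with `2`-Lipschitz inverse (triangle inequality), surjective
(Banach's fixed-point theorem for `x ↦ z - u x`), with invertible derivative `id + Du`, so its
inverse is `C^∞` (`Homeomorph.contDiff_symm`). [folklore] -/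
theorem exists_ambientDiffeomorph_of_perturbation {u : E → E} (hu : ContDiff ℝ ∞ u)
    (hdu : ∀ y, ‖fderiv ℝ u y‖ ≤ 2⁻¹) :
    ∃ H : E ≃ₘ⟮𝓘(ℝ, E), 𝓘(ℝ, E)⟯ E, ∀ y, H y = y + u y := by
  have hud : Differentiable ℝ u := hu.differentiable (by simp)
  have hlip : LipschitzWith 2⁻¹ u := by
    refine lipschitzWith_of_nnnorm_fderiv_le hud fun y => ?_
    rw [← NNReal.coe_le_coe, coe_nnnorm, NNReal.coe_inv, NNReal.coe_ofNat]
    exact hdu y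
  set f : E → E := fun y => y + u y with hf
  have hanti : AntilipschitzWith 2 f := by
    refine AntilipschitzWith.of_le_mul_dist fun x y => ?_
    have h1 : dist (u x) (u y) ≤ 2⁻¹ * dist x y := by
      have := hlip.dist_le_mul x y
      rwa [NNReal.coe_inv, NNReal.coe_ofNat] at this
    have h2 : dist x y ≤ dist (f x) (f y) + dist (u x) (u y) := by
      rw [dist_eq_norm, dist_eq_norm, dist_eq_norm]
      have : x - y = (f x - f y) - (u x - u y) := by simp only [hf]; abel
      rw [this]
      exact norm_sub_le _ _
    rw [NNReal.coe_ofNat]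
    linarith
  have hinj : Injective f := hanti.injective
  have hsurj : Surjective f := fun z => by
    have hc : ContractingWith 2⁻¹ (fun x => z - u x) := by
      refine ⟨two_inv_lt_one, ?_⟩
      have := (LipschitzWith.const (α := E) z).sub hlip
      simpa using this
    refine ⟨ContractingWith.fixedPoint _ hc, ?_⟩
    have hfix : z - u (ContractingWith.fixedPoint _ hc) = ContractingWith.fixedPoint _ hc :=
      hc.fixedPoint_isFixedPt
    exact eq_sub_iff_add_eq.mp hfix.symm
  let eqv : E ≃ E := Equiv.ofBijective f ⟨hinj, hsurj⟩
  have heqv' : ∀ y, f (eqv.symm y) = y := fun y => eqv.apply_symm_apply y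
  have hfs : ContDiff ℝ ∞ f := contDiff_id.add hu
  have hsymm_lip : LipschitzWith 2 eqv.symm := by
    refine LipschitzWith.of_dist_le_mul fun a b => ?_
    have := hanti.le_mul_dist (eqv.symm a) (eqv.symm b)
    rwa [heqv', heqv'] at this
  let H : E ≃ₜ E :=
    { toEquiv := eqv
      continuous_toFun := hfs.continuous
      continuous_invFun := hsymm_lip.continuous }
  -- the derivative `id + Du` is invertible
  have hderiv : ∀ y, HasFDerivAt f (ContinuousLinearMap.id ℝ E + fderiv ℝ u y) y := fun y =>
    (hasFDerivAt_id y).add (hud y).hasFDerivAt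
  have hinjA : ∀ y, Injective (ContinuousLinearMap.id ℝ E + fderiv ℝ u y) := by
    intro y v w hvw
    have h1 : v + fderiv ℝ u y v = w + fderiv ℝ u y w := by simpa using hvw
    have h2 : v - w = fderiv ℝ u y w - fderiv ℝ u y v := by
      rw [sub_eq_sub_iff_add_eq_add, h1, add_comm]
    have h3 : ‖v - w‖ ≤ 2⁻¹ * ‖v - w‖ := by
      calc ‖v - w‖ = ‖fderiv ℝ u y (w - v)‖ := by rw [h2, map_sub]
        _ ≤ ‖fderiv ℝ u y‖ * ‖w - v‖ := ContinuousLinearMap.le_opNorm _ _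
        _ ≤ 2⁻¹ * ‖v - w‖ := by
            rw [norm_sub_rev]
            exact mul_le_mul_of_nonneg_right (hdu y) (norm_nonneg _)
    have h4 : ‖v - w‖ = 0 := by linarith [norm_nonneg (v - w)]
    exact sub_eq_zero.mp (norm_eq_zero.mp h4)
  let A : E → E ≃L[ℝ] E := fun y =>
    (LinearEquiv.ofInjectiveEndo (ContinuousLinearMap.id ℝ E + fderiv ℝ u y).toLinearMap
      (hinjA y)).toContinuousLinearEquiv
  have hA : ∀ y, (A y : E →L[ℝ] E) = ContinuousLinearMap.id ℝ E + fderiv ℝ u y := fun y => by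
    ext v
    rfl
  have hderiv' : ∀ y, HasFDerivAt H (A y : E →L[ℝ] E) y := fun y => by
    rw [hA]
    exact hderiv y
  have hsymm_smooth : ContDiff ℝ ∞ (H.symm : E → E) := H.contDiff_symm hderiv' hfs
  exact ⟨{ toEquiv := eqv
           contMDiff_toFun := contMDiff_iff_contDiff.mpr hfs
           contMDiff_invFun := contMDiff_iff_contDiff.mpr hsymm_smooth }, fun y => rfl⟩

/-- **A `C¹`-small smooth perturbation of the identity supported in `M` is a self-diffeomorphism
of the open submanifold `M`.** If `u : E → E` is `C^∞` with `‖Du‖ ≤ 1/2` everywhere and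
`tsupport u ⊆ M`, then `y ↦ y + u y` restricts to a diffeomorphism of `M` (open-submanifold
structure): it is a diffeomorphism of `E` (`exists_ambientDiffeomorph_of_perturbation`) which is
the identity off `tsupport u`, hence maps `tsupport u` and therefore `M` onto themselves.
[folklore] -/
theorem exists_diffeomorph_of_perturbation (M : Opens E) {u : E → E} (hu : ContDiff ℝ ∞ u)
    (hdu : ∀ y, ‖fderiv ℝ u y‖ ≤ 2⁻¹) (hsupp : tsupport u ⊆ (M : Set E)) :
    ∃ h : M ≃ₘ⟮𝓘(ℝ, E), 𝓘(ℝ, E)⟯ M, ∀ y : M, (h y : E) = y + u y := by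
  obtain ⟨H, hH⟩ := exists_ambientDiffeomorph_of_perturbation hu hdu
  -- `H` is the identity off `tsupport u`, hence preserves `tsupport u` and `M`
  have hfix : ∀ y, y ∉ tsupport u → H y = y := fun y hy => by
    rw [hH, image_eq_zero_of_notMem_tsupport hy, add_zero]
  have hmemC : ∀ y, H y ∈ tsupport u ↔ y ∈ tsupport u := fun y => by
    constructor
    · intro h
      by_contra hy
      rw [hfix y hy] at h
      exact hy h
    · intro h
      by_contra hfy
      have h' : H y = y := H.injective (hfix _ hfy)
      rw [h'] at hfy
      exact hfy h
  have hmapM : ∀ y ∈ M, H y ∈ M := fun y hy => by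
    by_cases hC : y ∈ tsupport u
    · exact hsupp ((hmemC y).mpr hC)
    · rw [hfix y hC]
      exact hy
  have hmapM' : ∀ y ∈ M, H.symm y ∈ M := fun y hy => by
    by_cases hC : y ∈ tsupport u
    · have : H (H.symm y) ∈ tsupport u := by rwa [H.apply_symm_apply]
      exact hsupp ((hmemC _).mp this)
    · have h1 : H.symm y ∉ tsupport u := fun h' => hC (by
        have := (hmemC _).mpr h'
        rwa [H.apply_symm_apply] at this)
      have h2 : H (H.symm y) = H.symm y := hfix _ h1
      rw [H.apply_symm_apply] at h2
      rw [← h2]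
      exact hy
  refine ⟨{ toFun := fun y => ⟨H y, hmapM y y.2⟩
            invFun := fun y => ⟨H.symm y, hmapM' y y.2⟩
            left_inv := fun y => Subtype.ext (H.symm_apply_apply (y : E))
            right_inv := fun y => Subtype.ext (H.apply_symm_apply (y : E))
            contMDiff_toFun := ?_
            contMDiff_invFun := ?_ }, fun y => hH y⟩
  · refine (ContMDiff.subtypeVal_comp_iff M _).mp fun y => ?_
    show ContMDiffAt 𝓘(ℝ, E) 𝓘(ℝ, E) ∞ (fun y : M => H (y : E)) y
    exact contMDiffAt_subtype_iff.mpr (H.contMDiff _)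
  · refine (ContMDiff.subtypeVal_comp_iff M _).mp fun y => ?_
    show ContMDiffAt 𝓘(ℝ, E) 𝓘(ℝ, E) ∞ (fun y : M => H.symm (y : E)) y
    exact contMDiffAt_subtype_iff.mpr (H.symm.contMDiff _)

/-! ### The second paragraph of the proof of Thm. 4.1, proved -/

/-- **Uncountably many diffeomorphisms onto a fixed open set: two are `C¹`-close near a
compactum, and the correcting perturbation** (the data behind
`exists_ne_diffeomorph_eqOn_nhd_of_not_countable`; module docstring, steps 1–4). Let `M ⊆ E` be
open, `K ⊆ E` compact, and `φ_i : U_i ≅ M` (`i ∈ ι`, `ι` uncountable) diffeomorphisms of open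
neighbourhoods `U_i ⊇ K` onto `M`. Then for some `i ≠ j` there is a `C^∞` map `u : E → E` with
`‖Du‖ ≤ 1/2` everywhere and compact support inside `M` — so that `id + u` is a diffeomorphism of
`M`, and `id + τ u`, `0 ≤ τ ≤ 1`, an isotopy of such — and an open neighbourhood
`W ⊆ U_i ∩ U_j` of `K` with `φ_i x + u (φ_i x) = φ_j x` for all `x ∈ W`
(`u = χ • (φ_j ∘ φ_i⁻¹ - id)` for a bump `χ`). [cite: DeMichelisFreedman1992, proof of Thm. 4.1, second paragraph (p. 247)] [cite: HirschDT1976, Ch. 8, Thms. 1.3–1.5] -/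
theorem exists_ne_perturbation_of_not_countable (M : Opens E) {K : Set E}
    (hK : IsCompact K) {ι : Type*} (U : ι → Opens E)
    (φ : ∀ i, U i ≃ₘ⟮𝓘(ℝ, E), 𝓘(ℝ, E)⟯ M) (hKU : ∀ i, K ⊆ U i) (hι : ¬ Countable ι) :
    ∃ i j, i ≠ j ∧ ∃ u : E → E, ContDiff ℝ ∞ u ∧ (∀ y, ‖fderiv ℝ u y‖ ≤ 2⁻¹) ∧
      HasCompactSupport u ∧ tsupport u ⊆ (M : Set E) ∧
      ∃ W : Set E, IsOpen W ∧ K ⊆ W ∧ W ⊆ (U i : Set E) ∧ W ⊆ (U j : Set E) ∧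
        ∀ (x : E) (hi : x ∈ U i) (hj : x ∈ U j), x ∈ W →
          (φ i ⟨x, hi⟩ : E) + u (φ i ⟨x, hi⟩) = (φ j ⟨x, hj⟩ : M) := by
  classical
  -- Step 0: ambient extensions `F i` of `φ i` and `G i` of `(φ i)⁻¹`
  choose F G hF hG hFφ hGφ hFM hGU hGF hFG using
    fun i => exists_extend_diffeomorph (U i) M (φ i)
  -- Step 1: a common compact neighbourhood `L = cthickening ρ K ⊆ U i` on an uncountable `T₁`
  choose r hr0 hrU using fun i => hK.exists_cthickening_subset_open (U i).isOpen (hKU i)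
  have hT₀ : ¬ (univ : Set ι).Countable := by rwa [countable_univ_iff]
  have hcov₁ : (univ : Set ι) ⊆ ⋃ n ∈ (univ : Set ℕ), {i | (1 : ℝ) / (n + 1) < r i} := by
    intro i _
    obtain ⟨n, hn⟩ := exists_nat_one_div_lt (hr0 i)
    exact mem_iUnion₂.mpr ⟨n, mem_univ n, hn⟩
  obtain ⟨n₁, -, hT₁⟩ :=
    exists_not_countable_inter_of_subset_biUnion hT₀ countable_univ _ hcov₁
  set T₁ : Set ι := univ ∩ {i | (1 : ℝ) / (n₁ + 1) < r i} with hT₁def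
  set ρ : ℝ := 1 / (n₁ + 1) with hρ
  have hρ0 : 0 < ρ := Nat.one_div_pos_of_nat
  set L : Set E := cthickening ρ K with hLdef
  set V : Set E := thickening ρ K with hVdef
  have hLc : IsCompact L := hK.cthickening
  have hVopen : IsOpen V := isOpen_thickening
  have hVL : V ⊆ L := thickening_subset_cthickening ρ K
  have hKV : K ⊆ V := self_subset_thickening hρ0 K
  have hLU : ∀ i ∈ T₁, L ⊆ (U i : Set E) := fun i hi =>
    (cthickening_mono (le_of_lt hi.2) K).trans (hrU i)
  -- Step 2: per-index data — the open set `O i ⊆ M`, the compactum `F i '' K ⊆ O i`, a bump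
  -- `χ i` (`= 1` near `F i '' K`, compact support in `O i`) and derivative bounds `N i`, `B i`
  set O : ι → Set E := fun i => (M : Set E) ∩ G i ⁻¹' V with hOdef
  have hOopen : ∀ i, IsOpen (O i) := fun i =>
    (hG i).continuousOn.isOpen_inter_preimage M.isOpen hVopen
  have hsc : ∀ i, IsCompact (F i '' K) := fun i =>
    hK.image_of_continuousOn ((hF i).continuousOn.mono (hKU i))
  have hsO : ∀ i, F i '' K ⊆ O i := by
    rintro i _ ⟨x, hx, rfl⟩
    have hxU : x ∈ U i := hKU i hx
    refine ⟨hFM i x hxU, ?_⟩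
    show G i (F i x) ∈ V
    rw [hGF i x hxU]
    exact hKV hx
  choose δ hδ0 hδO using fun i => (hsc i).exists_cthickening_subset_open (hOopen i) (hsO i)
  have htc : ∀ i, IsCompact (cthickening (δ i) (F i '' K)) := fun i => (hsc i).cthickening
  have hst : ∀ i, F i '' K ⊆ interior (cthickening (δ i) (F i '' K)) := fun i =>
    (self_subset_thickening (hδ0 i) _).trans (thickening_subset_interior_cthickening _ _)
  choose χ hχ1 hχ0 hχ01 using fun i =>
    exists_contMDiffMap_one_nhds_of_subset_interior 𝓘(ℝ, E) (hsc i).isClosed (hst i)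
      (n := (⊤ : ℕ∞))
  have hχs : ∀ i, ContDiff ℝ ∞ (χ i) := fun i => contMDiff_iff_contDiff.mp (χ i).contMDiff
  have hχsupp : ∀ i, tsupport (χ i) ⊆ cthickening (δ i) (F i '' K) := fun i =>
    closure_minimal (fun y hy => by_contra fun h => hy (hχ0 i y h)) (htc i).isClosed
  have hχc : ∀ i, HasCompactSupport (χ i) := fun i => HasCompactSupport.intro (htc i) (hχ0 i)
  have hN : ∀ i, ∃ N : ℝ, ∀ y, ‖fderiv ℝ (χ i) y‖ ≤ N := fun i =>
    ((hχs i).continuous_fderiv (by simp)).bounded_above_of_compact_support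
      ((hχc i).fderiv (𝕜 := ℝ))
  choose N hN using hN
  have hB : ∀ i, ∃ B : ℝ, ∀ y ∈ cthickening (δ i) (F i '' K), ‖fderiv ℝ (G i) y‖ ≤ B :=
    fun i => (htc i).exists_bound_of_continuousOn
      (((hG i).continuousOn_fderiv_of_isOpen M.isOpen (by simp)).mono
        ((hδO i).trans inter_subset_left))
  choose B hB using hB
  -- Step 3: second pigeonhole, on `⌈N i + B i⌉₊`
  have hcov₂ : T₁ ⊆ ⋃ n ∈ (univ : Set ℕ), {i | ⌈N i + B i⌉₊ = n} := fun i _ =>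
    mem_iUnion₂.mpr ⟨_, mem_univ _, rfl⟩
  obtain ⟨n₂, -, hT₂⟩ :=
    exists_not_countable_inter_of_subset_biUnion hT₁ countable_univ _ hcov₂
  set T₂ : Set ι := T₁ ∩ {i | ⌈N i + B i⌉₊ = n₂} with hT₂def
  have hT₂T₁ : T₂ ⊆ T₁ := inter_subset_left
  set ε : ℝ := 1 / (2 * (n₂ + 1)) with hεdef
  have hε0 : 0 < ε := by positivity
  have hεNB : ∀ i ∈ T₂, (N i + B i) * ε ≤ 2⁻¹ := by
    intro i hi
    have h1 : N i + B i ≤ n₂ := by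
      rw [← hi.2]
      exact Nat.le_ceil _
    have h2 : (n₂ : ℝ) * ε ≤ 2⁻¹ := by
      rw [hεdef, mul_one_div, div_le_iff₀ (by positivity)]
      have : (2 : ℝ)⁻¹ * (2 * ((n₂ : ℝ) + 1)) = n₂ + 1 := by ring
      rw [this]
      linarith
    calc (N i + B i) * ε ≤ n₂ * ε := mul_le_mul_of_nonneg_right h1 hε0.le
      _ ≤ 2⁻¹ := h2
  -- Step 4: two `C¹`-close members, by separability of `C(L, E × (E →L[ℝ] E))`
  haveI : CompactSpace L := isCompact_iff_compactSpace.mp hLc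
  have hcontΨ : ∀ i ∈ T₁, ContinuousOn (fun x => (F i x, fderiv ℝ (F i) x)) L := fun i hi =>
    ((hF i).continuousOn.mono (hLU i hi)).prodMk
      (((hF i).continuousOn_fderiv_of_isOpen (U i).isOpen (by simp)).mono (hLU i hi))
  let Ψ : T₂ → C(L, E × (E →L[ℝ] E)) := fun i =>
    ⟨L.restrict fun x => (F i x, fderiv ℝ (F i) x),
      continuousOn_iff_continuous_restrict.mp (hcontΨ i (hT₂T₁ i.2))⟩
  have hΨ : ∀ (i : T₂) (x : L), Ψ i x = (F i x, fderiv ℝ (F i) x) := fun _ _ => rfl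
  obtain ⟨⟨a, haT₂⟩, ⟨b, hbT₂⟩, hab, hdist⟩ := exists_ne_dist_lt_of_not_countable' hT₂ Ψ hε0
  have hab' : a ≠ b := fun h => hab (Subtype.ext h)
  have hclose : ∀ x ∈ L, dist (F a x) (F b x) < ε ∧
      dist (fderiv ℝ (F a) x) (fderiv ℝ (F b) x) < ε := by
    intro x hx
    have h := (ContinuousMap.dist_apply_le_dist (f := Ψ ⟨a, haT₂⟩) (g := Ψ ⟨b, hbT₂⟩)
      ⟨x, hx⟩).trans_lt hdist
    rwa [hΨ, hΨ, Prod.dist_eq, max_lt_iff] at h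
  have haT₁ : a ∈ T₁ := hT₂T₁ haT₂
  have hbT₁ : b ∈ T₁ := hT₂T₁ hbT₂
  -- Step 5: the perturbation `u = χ a • (F b ∘ G a - id)` and its derivative bound
  have htO : cthickening (δ a) (F a '' K) ⊆ O a := hδO a
  have htM : cthickening (δ a) (F a '' K) ⊆ (M : Set E) := htO.trans inter_subset_left
  set g : E → E := fun y => F b (G a y) with hgdef
  set u : E → E := fun y => χ a y • (g y - y) with hudef
  have hgdiff : ∀ y ∈ O a, ContDiffAt ℝ ∞ g y := fun y hy => by
    have h1 : ContDiffAt ℝ ∞ (G a) y := (hG a).contDiffAt (M.isOpen.mem_nhds hy.1)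
    have h2 : ContDiffAt ℝ ∞ (F b) (G a y) :=
      (hF b).contDiffAt ((U b).isOpen.mem_nhds (hLU b hbT₁ (hVL hy.2)))
    exact h2.comp y h1
  have hu : ContDiff ℝ ∞ u := contDiff_smul_of_tsupport (hχs a) fun y hy =>
    (hgdiff y (htO (hχsupp a hy))).sub contDiffAt_id
  have husupp : tsupport u ⊆ (M : Set E) :=
    ((tsupport_smul_subset_left _ _).trans (hχsupp a)).trans htM
  have hdu : ∀ y, ‖fderiv ℝ u y‖ ≤ 2⁻¹ := by
    intro y
    by_cases hy : y ∈ tsupport (χ a)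
    · have hyt : y ∈ cthickening (δ a) (F a '' K) := hχsupp a hy
      have hyO : y ∈ O a := htO hyt
      have hyM : y ∈ (M : Set E) := hyO.1
      have hxV : G a y ∈ V := hyO.2
      have hxL : G a y ∈ L := hVL hxV
      have hxUa : G a y ∈ U a := hLU a haT₁ hxL
      have hxUb : G a y ∈ U b := hLU b hbT₁ hxL
      have hFx : F a (G a y) = y := hFG a y hyM
      have hGd : DifferentiableAt ℝ (G a) y :=
        ((hG a).contDiffAt (M.isOpen.mem_nhds hyM)).differentiableAt (by simp)
      have hFad : DifferentiableAt ℝ (F a) (G a y) :=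
        ((hF a).contDiffAt ((U a).isOpen.mem_nhds hxUa)).differentiableAt (by simp)
      have hFbd : DifferentiableAt ℝ (F b) (G a y) :=
        ((hF b).contDiffAt ((U b).isOpen.mem_nhds hxUb)).differentiableAt (by simp)
      have hid : (fderiv ℝ (F a) (G a y)).comp (fderiv ℝ (G a) y) = ContinuousLinearMap.id ℝ E :=
        fderiv_comp_fderiv_eq_id M.isOpen hyM (hFG a) hGd hFad
      have hgd : HasFDerivAt g ((fderiv ℝ (F b) (G a y)).comp (fderiv ℝ (G a) y)) y :=
        hFbd.hasFDerivAt.comp y hGd.hasFDerivAt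
      have hud' : HasFDerivAt u (χ a y • ((fderiv ℝ (F b) (G a y)).comp (fderiv ℝ (G a) y) -
          ContinuousLinearMap.id ℝ E) + (fderiv ℝ (χ a) y).smulRight (g y - y)) y :=
        ((hχs a).differentiable (by simp) y).hasFDerivAt.smul (hgd.sub (hasFDerivAt_id y))
      rw [hud'.fderiv]
      have hB' : ‖fderiv ℝ (G a) y‖ ≤ B a := hB a y hyt
      have h1 : ‖(fderiv ℝ (F b) (G a y)).comp (fderiv ℝ (G a) y) -
          ContinuousLinearMap.id ℝ E‖ ≤ ε * B a := by
        rw [← hid, ← ContinuousLinearMap.sub_comp]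
        refine (ContinuousLinearMap.opNorm_comp_le _ _).trans ?_
        refine mul_le_mul ?_ hB' (norm_nonneg _) hε0.le
        rw [← dist_eq_norm, dist_comm]
        exact (hclose _ hxL).2.le
      have h2 : ‖g y - y‖ ≤ ε := by
        have : g y - y = F b (G a y) - F a (G a y) := by rw [hFx]
        rw [this, ← dist_eq_norm, dist_comm]
        exact (hclose _ hxL).1.le
      have hχle : ‖χ a y‖ ≤ 1 := by
        have := hχ01 a y
        rw [Real.norm_eq_abs, abs_le]
        exact ⟨by linarith [this.1], this.2⟩
      have hNnn : 0 ≤ N a := (norm_nonneg _).trans (hN a y)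
      calc ‖χ a y • ((fderiv ℝ (F b) (G a y)).comp (fderiv ℝ (G a) y) -
                ContinuousLinearMap.id ℝ E) + (fderiv ℝ (χ a) y).smulRight (g y - y)‖
          ≤ ‖χ a y • ((fderiv ℝ (F b) (G a y)).comp (fderiv ℝ (G a) y) -
                ContinuousLinearMap.id ℝ E)‖ + ‖(fderiv ℝ (χ a) y).smulRight (g y - y)‖ :=
            norm_add_le _ _
        _ ≤ 1 * (ε * B a) + N a * ε := by
            refine add_le_add ?_ ?_
            · rw [norm_smul]
              exact mul_le_mul hχle h1 (norm_nonneg _) zero_le_one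
            · rw [ContinuousLinearMap.norm_smulRight_apply]
              exact mul_le_mul (hN a y) h2 (norm_nonneg _) hNnn
        _ = (N a + B a) * ε := by ring
        _ ≤ 2⁻¹ := hεNB a haT₂
    · have h0 : u =ᶠ[𝓝 y] fun _ => 0 := by
        filter_upwards [notMem_tsupport_iff_eventuallyEq.mp hy] with z hz
        simp [hudef, hz]
      rw [h0.fderiv_eq]
      simp
  -- Step 6: `χ a = 1` on an open `N ⊇ F a '' K`, so `φ a + u ∘ φ a = φ b` on the open
  -- neighbourhood `W = U a ∩ F a ⁻¹' N ∩ U b` of `K`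
  obtain ⟨N, hNopen, hKN, hN1⟩ := eventually_nhdsSet_iff_exists.mp (hχ1 a)
  refine ⟨a, b, hab', u, hu, hdu, ?_, husupp, ((U a : Set E) ∩ F a ⁻¹' N) ∩ U b,
    ((hF a).continuousOn.isOpen_inter_preimage (U a).isOpen hNopen).inter (U b).isOpen,
    fun x hx => ⟨⟨hKU a hx, hKN ⟨x, hx, rfl⟩⟩, hKU b hx⟩,
    fun x hx => hx.1.1, fun x hx => hx.2, fun x hi hj hxW => ?_⟩
  · exact (htc a).of_isClosed_subset (isClosed_tsupport u)
      ((tsupport_smul_subset_left _ _).trans (hχsupp a))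
  · have hχ1' : χ a (F a x) = 1 := hN1 _ hxW.1.2
    rw [← hFφ a ⟨x, hi⟩, ← hFφ b ⟨x, hj⟩]
    show F a x + χ a (F a x) • (F b (G a (F a x)) - F a x) = F b x
    rw [hχ1', one_smul, hGF a x hi]
    abel

/-- **Uncountably many diffeomorphisms onto a fixed open set: two differ NEAR a compactum by an
ambient diffeomorphism** (neighbourhood form of the "general fact" of the second paragraph of the
proof of DeMichelis–Freedman's Thm. 4.1, for any finite-dimensional real normed space and any
compact `K`). Let `M ⊆ E` be open, `K ⊆ E` compact, and `φ_i : U_i ≅ M` (`i ∈ ι`, `ι`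
uncountable) diffeomorphisms of open neighbourhoods `U_i ⊇ K` onto `M`. Then for some `i ≠ j`
there are a diffeomorphism `h : M ≅ M` and an OPEN neighbourhood `W` of `K`, `W ⊆ U_i ∩ U_j`,
with `h (φ_i x) = φ_j x` for all `x ∈ W`. Proof: module docstring, steps 1–4 (two members
`C¹`-close near `K` by second countability of `C(L, E × (E →L[ℝ] E))`; then
`h = id + χ • (φ_j ∘ φ_i⁻¹ - id)`, a compactly supported `C¹`-small perturbation of the identity;
the bump `χ` is `= 1` on an open neighbourhood `N` of `φ_i(K)`, and `W = U_i ∩ φ_i⁻¹(N) ∩ U_j`).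
Consequently a diffeomorphism `φ_j⁻¹ ∘ h ∘ φ_i : U_i ≅ U_j` restricting to the IDENTITY ON A
NEIGHBOURHOOD of `K` exists as soon as uncountably many `U_i ⊇ K` are diffeomorphic to one `M` —
so the first paragraph of the printed proof (the gauge-theoretic no-go) is needed only in the
form "no diffeomorphism `R⁴_s → R⁴_t`, `s ≠ t`, is the identity near `K`" (§0, p. 220: "Suppose
two pairs `(R⁴_s, K)`, `(R⁴_t, K)`, `s < t`, are diffeomorphic relative to the identity on `K`").
The source argues instead through countability of embeddings up to isotopy ("a smooth compact
manifold admits only countably many smooth embeddings, up to isotopy, into any smooth metrizable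
manifold … [15]") and isotopy extension. [cite: DeMichelisFreedman1992, proof of Thm. 4.1, second paragraph (p. 247); §0 (p. 220)] [cite: HirschDT1976, Ch. 8, Thms. 1.3–1.5] -/
theorem exists_ne_diffeomorph_eqOn_nhd_of_not_countable (M : Opens E) {K : Set E}
    (hK : IsCompact K) {ι : Type*} (U : ι → Opens E)
    (φ : ∀ i, U i ≃ₘ⟮𝓘(ℝ, E), 𝓘(ℝ, E)⟯ M) (hKU : ∀ i, K ⊆ U i) (hι : ¬ Countable ι) :
    ∃ i j, i ≠ j ∧ ∃ h : M ≃ₘ⟮𝓘(ℝ, E), 𝓘(ℝ, E)⟯ M, ∃ W : Set E, IsOpen W ∧ K ⊆ W ∧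
      W ⊆ (U i : Set E) ∧ W ⊆ (U j : Set E) ∧
      ∀ (x : E) (hi : x ∈ U i) (hj : x ∈ U j), x ∈ W →
        ((h (φ i ⟨x, hi⟩) : M) : E) = (φ j ⟨x, hj⟩ : M) := by
  obtain ⟨a, b, hab, u, hu, hdu, -, husupp, W, hWo, hKW, hWa, hWb, hW⟩ :=
    exists_ne_perturbation_of_not_countable M hK U φ hKU hι
  -- `h = id + u` is a diffeomorphism of `M`, and `h ∘ φ a = φ b` on `W`
  obtain ⟨h, hh⟩ := exists_diffeomorph_of_perturbation M hu hdu husupp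
  refine ⟨a, b, hab, h, W, hWo, hKW, hWa, hWb, fun x hi hj hxW => ?_⟩
  rw [hh]
  exact hW x hi hj hxW

/-- **Uncountably many diffeomorphisms onto a fixed open set: two differ on a compactum by an
ambient diffeomorphism** (the "general fact" of the second paragraph of the proof of
DeMichelis–Freedman's Thm. 4.1, in the ambient form used by its third paragraph; the hypothesis
`hgen` of `deMichelisFreedman1992_countableClasses_of_core`, for any finite-dimensional real
normed space and any compact `K`). Let `M ⊆ E` be open, `K ⊆ E` compact, and
`φ_i : U_i ≅ M` (`i ∈ ι`, `ι` uncountable) diffeomorphisms of open neighbourhoods `U_i ⊇ K`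
onto `M`. Then for some `i ≠ j` there is a diffeomorphism `h : M ≅ M` with `h (φ_i x) = φ_j x`
for all `x ∈ K` — the pointwise-on-`K` corollary of the neighbourhood form
`exists_ne_diffeomorph_eqOn_nhd_of_not_countable`. The source argues instead through
countability of embeddings up to isotopy ("a smooth compact manifold admits only countably many
smooth embeddings, up to isotopy, into any smooth metrizable manifold … [15]") and isotopy
extension. [cite: DeMichelisFreedman1992, proof of Thm. 4.1, second paragraph (p. 247)] [cite: HirschDT1976, Ch. 8, Thms. 1.3–1.5] -/
theorem exists_ne_diffeomorph_apply_eq_of_not_countable (M : Opens E) {K : Set E}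
    (hK : IsCompact K) {ι : Type*} (U : ι → Opens E)
    (φ : ∀ i, U i ≃ₘ⟮𝓘(ℝ, E), 𝓘(ℝ, E)⟯ M) (hKU : ∀ i, K ⊆ U i) (hι : ¬ Countable ι) :
    ∃ i j, i ≠ j ∧ ∃ h : M ≃ₘ⟮𝓘(ℝ, E), 𝓘(ℝ, E)⟯ M,
      ∀ (x : E) (hi : x ∈ U i) (hj : x ∈ U j), x ∈ K →
        ((h (φ i ⟨x, hi⟩) : M) : E) = (φ j ⟨x, hj⟩ : M) := by
  obtain ⟨i, j, hij, h, W, -, hKW, -, -, hW⟩ :=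
    exists_ne_diffeomorph_eqOn_nhd_of_not_countable M hK U φ hKU hι
  exact ⟨i, j, hij, h, fun x hi hj hx => hW x hi hj (hKW hx)⟩

end General

/-! ### Consequences for DeMichelis–Freedman's Thm. 4.1: the leaf and the tree's fact from the no-go alone -/

/-- **DeMichelis–Freedman 1992, Thm. 4.1 — the leaf (the `CS`-indexed nested family of open
`ℝ⁴`-homeomorphs with countable diffeomorphism classes) from the gauge-theoretic no-go ALONE.**
The conclusion is the statement of the former decomposition child
`deMichelisFreedman1992_countableClasses` of `ExoticOpenFourSpaceProofs`, merged back into this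
cone's single proof obligation by its D-0026 review and therefore spelled out (it is the
hypothesis of `deMichelisFreedman1992_continuum_of_countableClasses`). The hypothesis `hcore` is
the first paragraph of the printed proof (p. 247): the nested family `R⁴_t ⊆ ℝ⁴`, `t ∈ CS`, of
open subsets homeomorphic to `ℝ⁴` comes with a compactum `K ⊆ R⁴_t` (a smooth compact domain)
such that no diffeomorphism `R⁴_s → R⁴_t`, `s ≠ t`, restricts to the identity on `K` ("This
leads via Theorem 2.1 to a contradiction and the conclusion that if there is a diffeomorphism
`d : R⁴_s → R⁴_t`, then `d` restricted to `K` is not the identity"). The second paragraph (`hgen` of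
`deMichelisFreedman1992_countableClasses_of_core`) is now the theorem
`exists_ne_diffeomorph_apply_eq_of_not_countable`. What remains undischarged is exactly the
gauge theory (Kotschick's `Φ`-invariant, Taubes' end-periodic theory, Thm. 2.1) and Freedman's
structure theorem (Thm. 3.1) with the ribbon polar coordinates (Thm. 3.2).
[cite: DeMichelisFreedman1992, Thm. 4.1 and its proof (pp. 246–247)] -/
theorem deMichelisFreedman1992_countableClasses_of_nogo
    (hcore : ∃ (R : cantorSet → Opens (EuclideanSpace ℝ (Fin 4)))
      (K : Set (EuclideanSpace ℝ (Fin 4))), Monotone R ∧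
      (∀ t, Nonempty (R t ≃ₜ EuclideanSpace ℝ (Fin 4))) ∧ IsSmoothCompactDomain K ∧
      (∀ t, K ⊆ R t) ∧
      ∀ s t, s ≠ t → ∀ d : R s ≃ₘ⟮𝓡 4, 𝓡 4⟯ R t,
        ∃ x : R s, (x : EuclideanSpace ℝ (Fin 4)) ∈ K ∧
          ((d x : R t) : EuclideanSpace ℝ (Fin 4)) ≠ x) :
    ∃ R : cantorSet → Opens (EuclideanSpace ℝ (Fin 4)), Monotone R ∧
      (∀ t, Nonempty (R t ≃ₜ EuclideanSpace ℝ (Fin 4))) ∧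
      ∀ t, {t' | Nonempty (R t' ≃ₘ⟮𝓡 4, 𝓡 4⟯ R t)}.Countable :=
  deMichelisFreedman1992_countableClasses_of_core hcore fun M _ hK _ U φ hKU hι =>
    exists_ne_diffeomorph_apply_eq_of_not_countable M hK.isCompact U φ hKU hι

/-- **The tree's fact `deMichelisFreedman1992_continuum` from the gauge-theoretic no-go alone**
(through the leaf and Cor. 4.1, `deMichelisFreedman1992_continuum_of_countableClasses`): the
discharge `deMichelisFreedman1992_continuum_holds` now reduces exactly to the first paragraph of
the printed proof of Thm. 4.1. [cite: DeMichelisFreedman1992, Thm. 4.1, Cor. 4.1 and their proofs (pp. 246–248)] -/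
theorem deMichelisFreedman1992_continuum_of_nogo
    (hcore : ∃ (R : cantorSet → Opens (EuclideanSpace ℝ (Fin 4)))
      (K : Set (EuclideanSpace ℝ (Fin 4))), Monotone R ∧
      (∀ t, Nonempty (R t ≃ₜ EuclideanSpace ℝ (Fin 4))) ∧ IsSmoothCompactDomain K ∧
      (∀ t, K ⊆ R t) ∧
      ∀ s t, s ≠ t → ∀ d : R s ≃ₘ⟮𝓡 4, 𝓡 4⟯ R t,
        ∃ x : R s, (x : EuclideanSpace ℝ (Fin 4)) ∈ K ∧
          ((d x : R t) : EuclideanSpace ℝ (Fin 4)) ≠ x) :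
    deMichelisFreedman1992_continuum :=
  deMichelisFreedman1992_continuum_of_countableClasses
    (deMichelisFreedman1992_countableClasses_of_nogo hcore)

end Literature.Barriers.SmoothPoincare4
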